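import Summits.BirchSwinnertonDyer.Rank1Residual.X4.KuriharaLevelLowering
import Mathlib.NumberTheory.LegendreSymbol.Basic
import HarnessLib

/-!
# Level lowering kills Kurihara numbers mod `p`, part 4: the certificate TRANSPORTS along the quadratic twist `W = V ⊗ χ` — it can be computed on the semistable twist `V` at level `N/p²` (cell `b2b-bsdres`, seat additive-p4, line V40)

HONEST FRAMING (verbatim, cell `b2b-bsdres`): the goal of the cell is to DELETE the COMBINATION-SHAPED
residual classes for ALL analytic-rank `≤ 1` curves over `ℚ` — "full BSD formula for every rank `≤ 1`
curve in class `C`" assembled STRICTLY from published theorems — so that the rank-`≤ 1` remainder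
becomes exactly the CONSTRUCTION-SHAPED classes, which are TYPED (missing-input Props), NOT attempted;
this is not "finishing BSD". This file: research-route KERNEL THEOREMS (pure algebra over the tree's
`ratPlusSymbol` / `PlusSymbolLevelLowersAt`; no named fact, no conjecture, no definition, nothing booked;
class X4 stays CONSTRUCTION-SHAPED).

## What is proved

Part 3 (`KuriharaLevelLowering`) attached to a pair `(E, p)` the FINITE certificate
`PlusSymbolLevelLowersAt W p f ℓ` — a periodic `μ : ℚ → ℤ/p`, `T_q`-eigen at the Kolyvagin primes,
with `[r]⁺_f ≡ μ(r) − μ(ℓ r)` — and showed that it forces every mod-`p` Kurihara number of `f` to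
vanish (`∂^{(∞)} ≥ 1`). The instrument computes `μ` in the mod-`p` modular symbols of level `N/ℓ`,
which is out of reach for conductors `N ≳ 10⁵`. On the cells of class X4 where `E = W` is the
quadratic twist `V ⊗ χ_{p*}` of a curve `V` SEMISTABLE at `p` (cells (G, `e = 2`): `N_V = N/p²`;
(M): `N_V = N/p`), the modular symbol of `W` is a TWISTED SUM of the modular symbol of `V`
(Shimura 1971 Prop. 3.64 at the level of modular symbols — tree theorems
`ModularForms.modularSymbol_charTwist`, `ModularForms.exists_rat_forall_ratPlusSymbol_charTwist_eq`:
`[r]⁺_{f_W} = c · ∑_{u mod p} χ(u) [r + u/p]^±_{f_V}` with ONE constant `c`). This file proves that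
the certificate rides along:

* §1 (abstract, any commutative ring `R`, any modulus `m`, `χ : ℤ/m →* R`): the twisted function
  `T_χμ(r) := ∑_{u mod m} χ(u) μ(r + u/m)` of a periodic `μ` is periodic
  (`isPeriodic_twistSum`); re-indexing `u ↦ ku` for a unit `k mod m` with `χ(k)² = 1` gives
  `∑_u χ(u) μ(s + k·u/m) = χ(k) T_χμ(s)` (`twistSum_natMul`); hence `T_χμ` satisfies the weight-2
  HECKE RELATION at `q` with eigenvalue `χ(q)·a` when `μ` does with eigenvalue `a`
  (`heckeRel_twistSum` — the twist multiplies Hecke eigenvalues by `χ(q)`), and an `ℓ`-OLD identity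
  `φ = μ − w·μ∘[ℓ]` twists to `T_χφ = T_χμ − (w χ(ℓ))·(T_χμ)∘[ℓ]` (`twistSum_oldform`): the twist
  multiplies the oldform SIGN by `χ(ℓ)`.
* §2 `plusSymbolLevelLowersAt_of_twistSum`: if `[·]⁺_{f_W} ≡ c·T_χ([·]_{f_V})` (mod `p`) and the
  reduced symbol of `f_V` is `ℓ`-old with sign `w`, `μ_V` being `T_q`-eigen with eigenvalue `e_q`,
  `χ(q) e_q ≡ a_q(W)`, at the Kolyvagin primes `q` of `(W, p)`, and `w·χ(ℓ) = 1`, then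
  `PlusSymbolLevelLowersAt W p f_W ℓ` holds with `μ_W := c·T_χ μ_V`. (So a SPLIT Tamagawa prime `ℓ`
  of `W` with `χ(ℓ) = −1` is certified by the sign `w = −1` identity of the NON-split twist `V` at `ℓ`
  — exactly what the instrument observes: 738g1 @ 3 via `V` of conductor 246, `w = 2 ≡ −1`,
  `χ(2) = −1`; 1150e1 @ 5 via `V` of conductor 46, certificate found at level 23.)
* §3 the cell's case `m = p`, `χ = (·/p)` (Legendre, values in `ℤ/p`), from the ℚ-level identity
  `[r]⁺_{f_W} = c₀ · ∑_u (u/p)[r + u/p]⁺_{f_V}` (the shape of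
  `exists_rat_forall_ratPlusSymbol_charTwist_eq`, `p ≡ 1 (mod 4)`) with `p`-integral `c₀` and
  `p`-integral symbols of `f_V`: `plusSymbolLevelLowersAt_of_legendreTwist`. All consequences of part 3
  (`kuriharaNumber_eq_zero_of_plusSymbolLevelLowersAt`, `one_le_kuriharaPartialInfty_…`, the BSD_p
  closures of `X4/KimDefectLevelLowering`) then apply to `W` VERBATIM, with the certificate computed at
  level `N_V/ℓ` instead of `N_W/ℓ` (`p²` times smaller on the (G, e = 2) cell).

Where the hypotheses come from (not asserted here): `hsym` = the tree theorem on twisted modular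
symbols + `p`-adic unit-ness of the period ratio `c₀ = Ω⁺_{f_V}/(g(χ)Ω⁺_{f_W})` (Pal 2012 + the period
transfers, as in `Additive/SemistableTwistAnalytic`; per pair the instrument reads `c₀ = ±1`);
`haq` = `a_q(W) = (q/p)·a_q(V)` (tree `LFunction_quadraticTwist_pStar_apply`); the `V`-side oldform
identity = Ribet level lowering for `V[p] ≅ W[p] ⊗ χ` (unramified at `ℓ` iff `p ∣ ord_ℓ Δ`) + mod-`p`
multiplicity one — a per-pair certificate (cell instrument `twist40.gp`, EVIDENCE), never a fact.

## References

* G. Shimura, *Introduction to the arithmetic theory of automorphic functions* (1971), Prop. 3.64.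
* B. Mazur, J. Tate, J. Teitelbaum, Invent. Math. 84 (1986), §I.4 (4.2), §I.8. [cite: MazurTateTeitelbaum1986Invent, §I.4 (4.2) and §I.8]
* C.-H. Kim, Amer. J. Math. 148 (2026), §1.2.2, §1.4.3, Conj. 1.10. [cite: Kim2022StructureSelmer, §1.2.2 and §1.4.3]
* C.-H. Kim, M. Kim, H.-S. Sun, Selecta Math. 26 (2020), Rem. 2.3. [cite: KimKimSun2020Selecta, Rem. 2.3]
-/

noncomputable section

open scoped MatrixGroups ModularForm

open CongruenceSubgroup Finset

open Literature.NumberTheory.EllipticCurves Literature.NumberTheory.EllipticCurves.ModularForms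

namespace Summit.BirchSwinnertonDyer.Rank1Residual.LevelLowering

variable {R : Type*} [CommRing R]

/-! ### §1 Twisted sums of a periodic function: periodicity, re-indexing, Hecke, oldform shape -/

section TwistAlgebra

variable {m : ℕ} [NeZero m] (χ : ZMod m →* R) {μ : ℚ → R}

omit [CommRing R] in
/-- A periodic `μ` evaluated at `s + n/m` only sees `n mod m`. [folklore] -/
private theorem apply_add_natCast_div (hμ : IsPeriodic μ) (s : ℚ) (n : ℕ) :
    μ (s + (n : ℚ) / m) = μ (s + (((n : ZMod m).val : ℕ) : ℚ) / m) := by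
  rw [ZMod.val_natCast]
  have hm : (m : ℚ) ≠ 0 := by exact_mod_cast NeZero.ne m
  have hk : ((n % m : ℕ) : ℚ) = (n : ℚ) - (m : ℚ) * ((n / m : ℕ) : ℚ) := by
    have h' : ((n % m : ℕ) : ℚ) + (m : ℚ) * ((n / m : ℕ) : ℚ) = (n : ℚ) := by
      exact_mod_cast Nat.mod_add_div n m
    linarith
  refine hμ.eq_of_eq_add_int ((n / m : ℕ) : ℤ) ?_
  rw [Int.cast_natCast, hk]
  field_simp
  ring

/-- **The twisted sum `T_χμ(r) = ∑_{u mod m} χ(u) μ(r + u/m)` of a periodic `μ` is periodic.**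
[cite: MazurTateTeitelbaum1986Invent, §I.8] -/
theorem isPeriodic_twistSum (hμ : IsPeriodic μ) :
    IsPeriodic (fun r ↦ ∑ u : ZMod m, χ u * μ (r + (u.val : ℚ) / m)) := by
  intro r z
  refine Finset.sum_congr rfl fun u _ ↦ ?_
  rw [hμ.eq_of_eq_add_int z (by ring : r + z + (u.val : ℚ) / m = r + (u.val : ℚ) / m + z)]

/-- **Re-indexing by a unit**: for `k` invertible mod `m` with `χ(k)² = 1`,
`∑_u χ(u) μ(s + k·u/m) = χ(k) · ∑_u χ(u) μ(s + u/m)` (substitute `u ↦ ku`, `χ(u) = χ(k)χ(ku)`).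
[cite: MazurTateTeitelbaum1986Invent, §I.8] -/
theorem twistSum_natMul (hμ : IsPeriodic μ) {k : ℕ} (hk : IsUnit ((k : ℕ) : ZMod m))
    (hχk : χ k ^ 2 = 1) (s : ℚ) :
    ∑ u : ZMod m, χ u * μ (s + (k : ℚ) * u.val / m) =
      χ k * ∑ u : ZMod m, χ u * μ (s + (u.val : ℚ) / m) := by
  -- each term: `χ(u) μ(s + k u/m) = χ(k) · (χ(ku) μ(s + (ku)/m))`
  have hterm : ∀ u : ZMod m, χ u * μ (s + (k : ℚ) * u.val / m) =
      χ k * (χ ((k : ZMod m) * u) * μ (s + ((((k : ZMod m) * u).val : ℕ) : ℚ) / m)) := by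
    intro u
    have h1 : μ (s + (k : ℚ) * u.val / m) = μ (s + ((((k : ZMod m) * u).val : ℕ) : ℚ) / m) := by
      have := apply_add_natCast_div (m := m) hμ s (k * u.val)
      rw [show ((k * u.val : ℕ) : ZMod m) = (k : ZMod m) * u by
        rw [Nat.cast_mul, ZMod.natCast_zmod_val]] at this
      rw [← this]
      congr 1
      push_cast
      ring
    rw [h1, map_mul, ← mul_assoc, ← mul_assoc, ← sq, hχk, one_mul]
  simp_rw [hterm]
  rw [← Finset.mul_sum]
  congr 1
  exact Equiv.sum_comp hk.unit.mulLeft (fun v : ZMod m ↦ χ v * μ (s + (v.val : ℚ) / m))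

/-- **The twist multiplies Hecke eigenvalues by `χ(q)`**: if `μ` satisfies the weight-2 Hecke
relation at the prime `q` (invertible mod `m`, `χ(q)² = 1`) with eigenvalue `a`, then
`T_χμ` satisfies it with eigenvalue `χ(q)·a` (`a_q(f ⊗ χ) = χ(q) a_q(f)`; MTT §I.4 (4.2)).
[cite: MazurTateTeitelbaum1986Invent, §I.4 (4.2)] -/
theorem heckeRel_twistSum (hμ : IsPeriodic μ) {q : ℕ} (hq0 : q ≠ 0) (hq : IsUnit ((q : ℕ) : ZMod m))
    (hχq : χ q ^ 2 = 1) {a : R} (hH : HeckeRel μ q a) :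
    HeckeRel (fun r ↦ ∑ u : ZMod m, χ u * μ (r + (u.val : ℚ) / m)) q (χ q * a) := by
  intro r
  have hqQ : (q : ℚ) ≠ 0 := by exact_mod_cast hq0
  -- the Hecke relation of `μ` at the shifted points `r + q u/m`
  have hrow : ∀ u : ZMod m, ∑ j ∈ Finset.range q, μ ((r + j) / q + (u.val : ℚ) / m) =
      a * μ (r + (q : ℚ) * u.val / m) - μ (q * r + ((q ^ 2 : ℕ) : ℚ) * u.val / m) := by
    intro u
    have h := hH (r + (q : ℚ) * u.val / m)
    have e1 : ∀ j : ℕ, (r + (q : ℚ) * u.val / m + j) / q = (r + j) / q + (u.val : ℚ) / m := by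
      intro j; field_simp; ring
    have e2 : (q : ℚ) * (r + (q : ℚ) * u.val / m) = q * r + ((q ^ 2 : ℕ) : ℚ) * u.val / m := by
      push_cast; ring
    simp_rw [e1, e2] at h
    exact eq_sub_of_add_eq h
  -- unfold the Hecke sum of the twisted function and exchange the two sums
  simp only
  rw [Finset.sum_comm]
  simp_rw [← Finset.mul_sum, hrow, mul_sub, Finset.sum_sub_distrib]
  -- re-index the two shifted twisted sums
  have hunit2 : IsUnit (((q ^ 2 : ℕ) : ℕ) : ZMod m) := by
    rw [Nat.cast_pow]; exact hq.pow 2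
  have hχq2 : χ ((q ^ 2 : ℕ) : ZMod m) ^ 2 = 1 := by
    rw [Nat.cast_pow, map_pow, ← pow_mul, mul_comm, pow_mul, hχq, one_pow]
  have hχq2' : χ ((q ^ 2 : ℕ) : ZMod m) = 1 := by rw [Nat.cast_pow, map_pow, hχq]
  have hA : ∑ u : ZMod m, χ u * (a * μ (r + (q : ℚ) * u.val / m)) =
      a * (χ q * ∑ u : ZMod m, χ u * μ (r + (u.val : ℚ) / m)) := by
    rw [← twistSum_natMul χ hμ hq hχq, Finset.mul_sum]
    exact Finset.sum_congr rfl fun u _ ↦ by ring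
  have hB : ∑ u : ZMod m, χ u * μ (q * r + ((q ^ 2 : ℕ) : ℚ) * u.val / m) =
      ∑ u : ZMod m, χ u * μ (q * r + (u.val : ℚ) / m) := by
    rw [twistSum_natMul χ hμ hunit2 hχq2, hχq2', one_mul]
  rw [hA, hB]
  ring

/-- **An `ℓ`-old identity twists to an `ℓ`-old identity with the sign multiplied by `χ(ℓ)`**:
if `φ = μ − w·μ∘[ℓ]` with `ℓ` invertible mod `m` and `χ(ℓ)² = 1`, then
`T_χφ(r) = T_χμ(r) − (w χ(ℓ)) · T_χμ(ℓ r)`. [cite: MazurTateTeitelbaum1986Invent, §I.8] -/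
theorem twistSum_oldform (hμ : IsPeriodic μ) {φ : ℚ → R} {w : R} {ℓ : ℕ}
    (hℓ : IsUnit ((ℓ : ℕ) : ZMod m)) (hχℓ : χ ℓ ^ 2 = 1)
    (hφ : ∀ r : ℚ, φ r = μ r - w * μ (ℓ * r)) (r : ℚ) :
    ∑ u : ZMod m, χ u * φ (r + (u.val : ℚ) / m) =
      ∑ u : ZMod m, χ u * μ (r + (u.val : ℚ) / m) -
        (w * χ ℓ) * ∑ u : ZMod m, χ u * μ (ℓ * r + (u.val : ℚ) / m) := by
  have e : ∀ u : ZMod m, (ℓ : ℚ) * (r + (u.val : ℚ) / m) = ℓ * r + (ℓ : ℚ) * u.val / m := by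
    intro u; ring
  simp_rw [hφ, e, mul_sub, Finset.sum_sub_distrib]
  rw [show ∑ u : ZMod m, χ u * (w * μ (ℓ * r + (ℓ : ℚ) * u.val / m)) =
      w * ∑ u : ZMod m, χ u * μ (ℓ * r + (ℓ : ℚ) * u.val / m) by
    rw [Finset.mul_sum]; exact Finset.sum_congr rfl fun u _ ↦ by ring,
    twistSum_natMul χ hμ hℓ hχℓ, mul_assoc]

/-- A Hecke relation survives multiplication of the function by a constant. [folklore] -/
private theorem heckeRel_const_mul {ν : ℚ → R} {q : ℕ} {a : R} (h : HeckeRel ν q a) (c : R) :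
    HeckeRel (fun r ↦ c * ν r) q a := by
  intro r
  have := congrArg (fun x ↦ c * x) (h r)
  simp only [mul_add, Finset.mul_sum] at this
  simp only
  rw [this]
  ring

end TwistAlgebra

/-! ### §2 The certificate transports along the twist -/

section Transport

variable (W : WeierstrassCurve ℚ) [W.IsGloballyMinimal] (p : ℕ) [Fact p.Prime]
  {m : ℕ} [NeZero m] (χ : ZMod m →* ZMod p)
  {NW NV : ℕ} (fW : CuspForm (Gamma0 NW) 2) (fV : CuspForm (Gamma0 NV) 2)

/-- **TRANSPORT OF THE LEVEL-LOWERING CERTIFICATE ALONG A TWIST.** Data: a character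
`χ : ℤ/m →* ℤ/p`; cusp forms `f_W`, `f_V` whose mod-`p` plus symbols are related by the twisted sum
with one constant `c`, `[r]⁺_{f_W} ≡ c · ∑_{u mod m} χ(u) [r + u/m]⁺_{f_V}` (`hsym`); an `ℓ`-OLD
identity with sign `w` for the reduced symbol of `f_V`, `[r]⁺_{f_V} ≡ μ(r) − w μ(ℓr)` (`hV`), `μ`
periodic and `T_q`-eigen with eigenvalue `e_q` at every Kolyvagin prime `q` of `(W, p)`, these primes
being invertible mod `m` with `χ(q)² = 1` and `χ(q) e_q ≡ a_q(W)` (`hH`); `ℓ` invertible mod `m`,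
`χ(ℓ)² = 1` and `w χ(ℓ) = 1`. THEN `PlusSymbolLevelLowersAt W p f_W ℓ`, with the witness
`μ_W = c · T_χμ` (§1: periodic, `T_q`-eigen with eigenvalue `χ(q)e_q = a_q(W)`, and
`c·T_χ(μ − wμ∘[ℓ]) = μ_W − (wχ(ℓ)) μ_W∘[ℓ] = μ_W − μ_W∘[ℓ]`).
[cite: Kim2022StructureSelmer, §1.2.2 and §1.4.3] [cite: MazurTateTeitelbaum1986Invent, §I.4 (4.2) and §I.8] -/
theorem plusSymbolLevelLowersAt_of_twistSum (c : ZMod p)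
    (hsym : ∀ r : ℚ, ((ratPlusSymbol fW r : ℚ) : ZMod p) =
      c * ∑ u : ZMod m, χ u * ((ratPlusSymbol fV (r + (u.val : ℚ) / m) : ℚ) : ZMod p))
    {μ : ℚ → ZMod p} (hμ : IsPeriodic μ) {w : ZMod p} {ℓ : ℕ}
    (hV : ∀ r : ℚ, ((ratPlusSymbol fV r : ℚ) : ZMod p) = μ r - w * μ (ℓ * r))
    (hℓ : IsUnit ((ℓ : ℕ) : ZMod m)) (hχℓ : χ ℓ ^ 2 = 1) (hw : w * χ ℓ = 1)
    (e : ℕ → ZMod p)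
    (hH : ∀ q : ℕ, Kato.IsKolyvaginPrime W p 1 q →
      HeckeRel μ q (e q) ∧ IsUnit ((q : ℕ) : ZMod m) ∧ χ q ^ 2 = 1 ∧
        χ q * e q = (W.frobeniusTrace q : ZMod p)) :
    PlusSymbolLevelLowersAt W p fW ℓ := by
  refine ⟨fun r ↦ c * ∑ u : ZMod m, χ u * μ (r + (u.val : ℚ) / m), ?_, ?_, ?_⟩
  · -- periodicity
    intro r z
    have hper := isPeriodic_twistSum χ hμ r z
    simp only at hper ⊢
    rw [hper]
  · -- Hecke at the Kolyvagin primes of `(W, p)`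
    intro q hq
    obtain ⟨hHq, hqu, hχq, haq⟩ := hH q hq
    rw [← haq]
    exact heckeRel_const_mul (heckeRel_twistSum χ hμ hq.prime.ne_zero hqu hχq hHq) c
  · -- the symbol identity
    intro r
    rw [hsym r, twistSum_oldform χ hμ hℓ hχℓ hV r, hw, one_mul, mul_sub]

end Transport

/-! ### §3 The cell's case: `W = V ⊗ χ_p`, `χ = (·/p)` with values in `ℤ/p` -/

section Legendre

variable {p : ℕ} [hp : Fact p.Prime]

/-- Casting a `p`-integral product of rationals to `ℤ/p`. [folklore] -/
private theorem ratCast_mul_of_not_dvd {a b : ℚ} (ha : ¬ p ∣ a.den) (hb : ¬ p ∣ b.den) :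
    ((a * b : ℚ) : ZMod p) = (a : ZMod p) * (b : ZMod p) :=
  Rat.cast_mul_of_ne_zero (mt (ZMod.natCast_eq_zero_iff _ _).mp ha)
    (mt (ZMod.natCast_eq_zero_iff _ _).mp hb)

/-- A sum of `p`-integral rationals is `p`-integral and its cast to `ℤ/p` is the sum of the casts.
[folklore] -/
private theorem ratCast_sum_of_not_dvd {ι : Type*} (s : Finset ι) (g : ι → ℚ)
    (h : ∀ i ∈ s, ¬ p ∣ (g i).den) :
    ¬ p ∣ (∑ i ∈ s, g i).den ∧ ((∑ i ∈ s, g i : ℚ) : ZMod p) = ∑ i ∈ s, ((g i : ℚ) : ZMod p) := by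
  classical
  induction s using Finset.induction_on with
  | empty => simp [hp.out.one_lt.ne']
  | insert a s has ih =>
    have ha : ¬ p ∣ (g a).den := h a (Finset.mem_insert_self a s)
    obtain ⟨hs, hcast⟩ := ih fun i hi ↦ h i (Finset.mem_insert_of_mem hi)
    rw [Finset.sum_insert has, Finset.sum_insert has]
    refine ⟨fun hd ↦ ?_, ?_⟩
    · have := hd.trans (Rat.add_den_dvd (g a) (∑ i ∈ s, g i))
      rcases (Nat.Prime.dvd_mul hp.out).mp this with h1 | h1
      · exact ha h1
      · exact hs h1
    · rw [Rat.cast_add_of_ne_zero (mt (ZMod.natCast_eq_zero_iff _ _).mp ha)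
        (mt (ZMod.natCast_eq_zero_iff _ _).mp hs), hcast]

/-- The Legendre symbol mod `p` read in `ℤ/p`, as a monoid homomorphism `ℤ/p →* ℤ/p` (Mathlib's
`quadraticChar (ZMod p)` post-composed with `ℤ → ℤ/p`); on `u` it is `((u/p) : ℤ/p)`. [folklore] -/
private theorem legendreHom_apply (u : ZMod p) :
    ((quadraticChar (ZMod p)).ringHomComp (Int.castRingHom (ZMod p))).toMonoidHom u =
      ((legendreSym p (u.val : ℤ) : ℤ) : ZMod p) := by
  rw [MulChar.coe_toMonoidHom, MulChar.ringHomComp_apply, legendreSym, Int.cast_natCast,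
    ZMod.natCast_zmod_val]
  rfl

/-- `((u/p))² = 1` in `ℤ/p` for `u` prime to `p`. [folklore] -/
private theorem legendreHom_sq_eq_one {n : ℕ} (hn : ¬ p ∣ n) :
    ((quadraticChar (ZMod p)).ringHomComp (Int.castRingHom (ZMod p))).toMonoidHom (n : ZMod p) ^ 2 = 1 := by
  have hn0 : (n : ZMod p) ≠ 0 := mt (ZMod.natCast_eq_zero_iff _ _).mp hn
  rw [MulChar.coe_toMonoidHom, MulChar.ringHomComp_apply, ← map_pow, quadraticChar_sq_one hn0]
  simp

/-- **THE CELL'S TRANSPORT: the level-lowering certificate of `W = V ⊗ χ_p` at a Tamagawa prime `ℓ`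
from the `V`-side data.** Hypotheses: the ℚ-level twist identity of the plus symbols with one
`p`-integral constant, `[r]⁺_{f_W} = c₀ · ∑_{u mod p} (u/p) [r + u/p]⁺_{f_V}` (`hsym`: the shape of
`ModularForms.exists_rat_forall_ratPlusSymbol_charTwist_eq` for `p ≡ 1 (mod 4)`; `hc`: `p ∤ den c₀` —
per pair `c₀ = ±1`); `p`-integral symbols of `f_V` (`hint`, e.g. tower surjectivity of `V`); the
`ℓ`-old identity of sign `w` for the reduced symbol of `f_V` (`hV`, the per-pair certificate computed at
level `N_V/ℓ`) with `μ` periodic and `T_q`-eigen with eigenvalue `a_q(V)` at the Kolyvagin primes of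
`(W, p)` (`hHV`), where `a_q(W) ≡ (q/p) a_q(V)` (`haq`, the twist relation); `p ∤ ℓ` and
`w · (ℓ/p) = 1`. Conclusion: `PlusSymbolLevelLowersAt W p f_W ℓ` — so every consequence of part 3
(all mod-`p` Kurihara numbers of `f_W` vanish, `∂^{(∞)} ≥ 1`, the BSD_p closures of
`X4/KimDefectLevelLowering`) applies to `W` with a certificate computed on `V`.
[cite: Kim2022StructureSelmer, §1.2.2 and §1.4.3] [cite: MazurTateTeitelbaum1986Invent, §I.4 (4.2) and §I.8] -/
theorem plusSymbolLevelLowersAt_of_legendreTwist (W V : WeierstrassCurve ℚ) [W.IsGloballyMinimal]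
    [V.IsGloballyMinimal]
    {NW NV : ℕ} (fW : CuspForm (Gamma0 NW) 2) (fV : CuspForm (Gamma0 NV) 2)
    (c₀ : ℚ) (hc : ¬ p ∣ c₀.den) (hint : ∀ x : ℚ, ¬ p ∣ (ratPlusSymbol fV x).den)
    (hsym : ∀ r : ℚ, ratPlusSymbol fW r =
      c₀ * ∑ u : ZMod p, (legendreSym p (u.val : ℤ) : ℚ) * ratPlusSymbol fV (r + (u.val : ℚ) / p))
    {μ : ℚ → ZMod p} (hμ : IsPeriodic μ) {w : ZMod p} {ℓ : ℕ} (hℓ : ¬ p ∣ ℓ)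
    (hV : ∀ r : ℚ, ((ratPlusSymbol fV r : ℚ) : ZMod p) = μ r - w * μ (ℓ * r))
    (hw : w * ((legendreSym p (ℓ : ℤ) : ℤ) : ZMod p) = 1)
    (hHV : ∀ q : ℕ, Kato.IsKolyvaginPrime W p 1 q → HeckeRel μ q (V.frobeniusTrace q : ZMod p))
    (haq : ∀ q : ℕ, Kato.IsKolyvaginPrime W p 1 q →
      (W.frobeniusTrace q : ZMod p) = ((legendreSym p (q : ℤ) : ℤ) : ZMod p) * V.frobeniusTrace q) :
    PlusSymbolLevelLowersAt W p fW ℓ := by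
  set χ : ZMod p →* ZMod p :=
    ((quadraticChar (ZMod p)).ringHomComp (Int.castRingHom (ZMod p))).toMonoidHom with hχdef
  have hχnat : ∀ n : ℕ, χ (n : ZMod p) = ((legendreSym p (n : ℤ) : ℤ) : ZMod p) := by
    intro n
    rw [hχdef, legendreHom_apply, ZMod.val_natCast, Int.natCast_mod, ← legendreSym.mod]
  -- the mod-`p` twist identity
  have hsymP : ∀ r : ℚ, ((ratPlusSymbol fW r : ℚ) : ZMod p) =
      (c₀ : ZMod p) * ∑ u : ZMod p, χ u * ((ratPlusSymbol fV (r + (u.val : ℚ) / p) : ℚ) : ZMod p) := by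
    intro r
    have hterm : ∀ u ∈ (Finset.univ : Finset (ZMod p)),
        ¬ p ∣ ((legendreSym p (u.val : ℤ) : ℚ) * ratPlusSymbol fV (r + (u.val : ℚ) / p)).den := by
      intro u _ hd
      have := hd.trans (Rat.mul_den_dvd _ _)
      rw [Rat.den_intCast, one_mul] at this
      exact hint _ this
    obtain ⟨hden, hcast⟩ := ratCast_sum_of_not_dvd (p := p) Finset.univ _ hterm
    rw [hsym r, ratCast_mul_of_not_dvd hc hden, hcast]
    congr 1
    refine Finset.sum_congr rfl fun u _ ↦ ?_
    rw [ratCast_mul_of_not_dvd (by rw [Rat.den_intCast]; exact hp.out.one_lt.ne' ∘ Nat.dvd_one.mp)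
      (hint _), Rat.cast_intCast, hχdef, legendreHom_apply]
  have hℓu : IsUnit ((ℓ : ℕ) : ZMod p) :=
    (ZMod.isUnit_iff_coprime ℓ p).mpr ((Nat.coprime_comm).mp ((Nat.Prime.coprime_iff_not_dvd hp.out).mpr hℓ))
  have hχℓ : χ ℓ ^ 2 = 1 := legendreHom_sq_eq_one hℓ
  have hw' : w * χ ℓ = 1 := by rwa [hχnat ℓ]
  refine plusSymbolLevelLowersAt_of_twistSum W p χ fW fV (c₀ : ZMod p) hsymP hμ hV hℓu hχℓ hw'
    (fun q ↦ χ q * (W.frobeniusTrace q : ZMod p)) fun q hq ↦ ?_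
  have hqp : ¬ p ∣ q := fun hd ↦
    hq.ne ((Nat.prime_dvd_prime_iff_eq hp.out hq.prime).mp hd).symm
  have hqu : IsUnit ((q : ℕ) : ZMod p) :=
    (ZMod.isUnit_iff_coprime q p).mpr ((Nat.coprime_comm).mp ((Nat.Prime.coprime_iff_not_dvd hp.out).mpr hqp))
  have hχq : χ q ^ 2 = 1 := legendreHom_sq_eq_one hqp
  refine ⟨?_, hqu, hχq, ?_⟩
  · -- `χ(q) a_q(W) = χ(q)² a_q(V) = a_q(V)`
    have : χ q * (W.frobeniusTrace q : ZMod p) = (V.frobeniusTrace q : ZMod p) := by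
      rw [haq q hq, ← hχnat q, ← mul_assoc, ← sq, hχq, one_mul]
    rw [this]
    exact hHV q hq
  · rw [← mul_assoc, ← sq, hχq, one_mul]

end Legendre

end Summit.BirchSwinnertonDyer.Rank1Residual.LevelLowering

end
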